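import Summits.BirchSwinnertonDyer.BirchSwinnertonDyer.Theorems.EisensteinPrimesGoodLatticeBDPValueImprimLambdaLEOfFactsSurC
import Literature.NumberTheory.GaloisCohomology.TateGlobalEulerCharacteristicTotallyComplex
import Summits.BirchSwinnertonDyer.BirchSwinnertonDyer.Theorems.EisensteinPrimesSurLambdaCaseCTCOfPoitouTate
import Summits.BirchSwinnertonDyer.BirchSwinnertonDyer.Theorems.EisensteinPrimesSurLambdaCaseCTCOfPoitouTateAt
import HarnessLib

/-!
# Crux `GoodLatticeBDPValue` (stmt-BirchSwinnertonDyer-19032), line `halves`: THE CRUX BY NAME FROM EIGHT LITERATURE NAMED FACTS —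
# research 6 · preprint-grade 1 · TEXTBOOK 1 (Milne ADT I 4.10 (a), AT THE FINITE SETS OF PLACES THE LINE READS); the by-name closure of the LEAD's skeleton v32

Cell `bsd-eis` (run/shared/lean/pub/bsd-eis/), LEAD seat `bsd-line-x1-p1` gen 10. `--supports stmt-BirchSwinnertonDyer-19032`.

v31 (`…OfNamedFactsV31.goodLatticeBDPValue_of_namedFacts₃₁`, p706477): the crux BY NAME from 8 names, the textbook one being
`∀ L [IsTotallyComplex L], GaloisCohomology.poitouTate_shaRestricted_tateDual_natural L` (Milne ADT I Thm. 4.10 (a) for `G_S` with the naturality of its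
pairing, quantified over EVERY set `S` of finite places, p704443). v32: that conjunct is NARROWED to the instances road «SUR-Λ» actually reads —
`∀ L [IsTotallyComplex L] (S : Set _), S.Finite → GaloisCohomology.poitouTate_shaRestricted_tateDual_natural_at L S` (the pointwise form, Literature p708774:
the body of the v31 fact AT `S`, token for token) — because `prop263_sur_of_crk_caseC_tc` binds one FINITE `Σ ⊇ S_p` and the consumer C7b-6 used the fact at
that `Σ` only; the implication is LEAD g10's re-typed END-COMPOSE `SurLambda.prop263_sur_of_crk_caseC_tc_of_poitouTateNaturalAt` (over the re-typed C7b-6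
`Greenberg2016.dualSha_torsion_of_poitouTateAt`). Result: `goodLatticeBDPValue_of_namedFacts₃₂ : ⟨proofThm422 ∧ thm513_disc ∧ thm331 ∧ thmII64⟩ →
thm222_anacong_goodLattice_of_fullDescentDatum → prop411_selmer_isAlmostDivisible →
⟨(∀ L [IsTotallyComplex L] S, S.Finite → poitouTate_shaRestricted_tateDual_natural_at L S) ∧ thm212⟩ → Theses.EisensteinPrimes.GoodLatticeBDPValue` :=
`…₂₈_ofSurC` fed the Tate THEOREM (Milne I 5.1 at totally complex fields, p703415) and the re-typed SUR-Λ THEOREM.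
BY-NAME SURFACE: 8 = research 6 (CGLS 2022 proof of 4.2.2, 5.1.3 (disc), 2.1.2; Bleher et al. 2020 3.3.1; de Shalit 1987 II.6.4; Greenberg 2016 4.1.1) ·
preprint-grade 1 (`_of_fullDescentDatum`) · textbook 1 (Milne I 4.10 (a) restricted, natural form, at finite `S` of totally complex fields — the target of
the background lane «PT-Ш-S-TC», whose finite-`S` engine will discharge it: v33).
HONEST FRAMING: CONDITIONAL on exactly these eight names; no Poitou–Tate duality is proved here (it is the textbook hypothesis); closes nothing by itself;
no summit statement / BSD / Mazur MC / IMC2 / KY 2.2.2 is proved for any curve.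
[claim: KellerYin2024, status: under-review]
[cite: KellerYin2024, Thm. 3.0.8 (IMC2), Thm. 1.4.1, Thms. 2.2.1–2.2.3] [cite: CastellaGrossiLeeSkinner2022, proof of Thm. 4.2.2, Thm. 5.1.3 with (disc), Thm. 2.1.2]
[cite: BleherEtAl2020, §3.3 Thm. 3.3.1] [cite: deShalit1987, II.6.4 Theorem (i)] [cite: Greenberg2016Selmer, Prop. 4.1.1, Prop. 2.6.3 (c)] [cite: Greenberg2010, Props. 2.1.1, 2.3.2, 3.1.1, 3.2.1 (c)]
[cite: MilneADT2006, I Thm. 4.10 (a), I Thm. 5.1] [cite: Harari2020, Thm. 17.13, Cor. 17.14] [cite: Kriz2016, Thm. 3, Def. 31 (5), Thm. 34 (3), Thm. 35]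
-/

noncomputable section

namespace Summit.BirchSwinnertonDyer.BirchSwinnertonDyer.Theorems.GoodLatticeBDPValueOfNamedFactsV32

open NumberField Literature.NumberTheory.EllipticCurves.CastellaGrossiLeeSkinner2022 Literature.NumberTheory.EllipticCurves.BCGKPST2020
  Literature.NumberTheory.EllipticCurves.DeShalit1987 Literature.NumberTheory.EllipticCurves.KellerYin2024
  Literature.NumberTheory.IwasawaTheory.Greenberg2016

/-- **THE CRUX BY NAME — `Theses.EisensteinPrimes.GoodLatticeBDPValue` — from EIGHT LITERATURE NAMED FACTS (the v32 surface: research 6 · preprint-grade 1 · textbook 1)**: stub 1 (CGLS 2022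
proof of Thm. 4.2.2, Thm. 5.1.3 (disc); Bleher et al. 2020 Thm. 3.3.1; de Shalit 1987 II.6.4), stub 3a-A (`thm222_anacong_goodLattice_of_fullDescentDatum`,
preprint-grade), stub 4 (Greenberg 2016 Prop. 4.1.1), stub 4b (Milne ADT I Thm. 4.10 (a) restricted, natural form, AT FINITE `S` of totally complex fields —
`poitouTate_shaRestricted_tateDual_natural_at`, from which Greenberg 2016 Prop. 2.6.3 (c) at totally complex fields is derived by
`SurLambda.prop263_sur_of_crk_caseC_tc_of_poitouTateNaturalAt`; CGLS 2022 Thm. 2.1.2); Milne ADT I 5.1 and Harari 17.13 (a) enter as TREE THEOREMS at totally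
complex fields. Composition: width seat w5 gen 9's `GoodLatticeBDPValueOfNamedFactsV28.goodLatticeBDPValue_of_namedFacts₂₈_ofSurC` fed
`forall_tateGlobalEulerPoincareCharacteristic_of_isTotallyComplex`. CONDITIONAL on exactly these eight names; closes nothing by itself; BSD is proved for no curve.
[claim: KellerYin2024, status: under-review]
[cite: KellerYin2024, Thm. 3.0.8 (IMC2)] [cite: Greenberg2016Selmer, Prop. 4.1.1, Prop. 2.6.3 (c)] [cite: Greenberg2010, Prop. 3.2.1 (c)] [cite: MilneADT2006, I Thm. 4.10 (a), I Thm. 5.1] -/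
theorem goodLatticeBDPValue_of_namedFacts₃₂
    (stub_publishedFacts :
      proofThm422_exists_isBDPLFunction_isTorsion_charIdeal_dvd ∧
        thm513_exists_isBDPLFunction_valueAtOne_disc ∧
        thm331_rubin_exists_katzMeasure₂_pseudoIso_span_eq ∧
        thmII64_katzMeasure₂_functionalEquation)
    (stub_anacongOfFullDescentDatum : thm222_anacong_goodLattice_of_fullDescentDatum)
    (stub_publishedFactsGreenberg : prop411_selmer_isAlmostDivisible)
    (stub_publishedFactsMore : (∀ (L : Type) [Field L] [NumberField L] [IsTotallyComplex L] (S : Set (IsDedekindDomain.HeightOneSpectrum (𝓞 L))),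
      S.Finite → Literature.NumberTheory.GaloisCohomology.poitouTate_shaRestricted_tateDual_natural_at L S) ∧ thm212_exists_isKatzLFunction) :
    Summit.BirchSwinnertonDyer.BirchSwinnertonDyer.Theses.EisensteinPrimes.GoodLatticeBDPValue :=
  GoodLatticeBDPValueOfNamedFactsV28.goodLatticeBDPValue_of_namedFacts₂₈_ofSurC stub_publishedFacts stub_anacongOfFullDescentDatum
    ⟨stub_publishedFactsGreenberg, Literature.NumberTheory.GaloisCohomology.forall_tateGlobalEulerPoincareCharacteristic_of_isTotallyComplex⟩
    ⟨Summit.BirchSwinnertonDyer.BirchSwinnertonDyer.Theorems.SurLambda.prop263_sur_of_crk_caseC_tc_of_poitouTateNaturalAt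
      stub_publishedFactsMore.1, stub_publishedFactsMore.2⟩

end Summit.BirchSwinnertonDyer.BirchSwinnertonDyer.Theorems.GoodLatticeBDPValueOfNamedFactsV32

end
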